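import Summits.CriticalPhenomena.PercolationContinuityZ3.Theses.PercNearOneGluing
import Literature.Probability.Percolation.PercolationProofs
import Literature.Probability.Percolation.ConditionalPositiveAssociationProofs
import Literature.Probability.Percolation.TwoClusterConditionalAssociationProofs
import Summits.CriticalPhenomena.PercolationContinuityZ3.Theorems.PercNearOneGluingAdditiveGluingGoodTwoRelays

/-! TTRL-lite variant V139 of stmt-CriticalPhenomena-4576

(`stub_goodStep`, move `specialise` / `fix_nat:n=5`).  No new definitions, no named facts. -/

namespace Summit.CriticalPhenomena.PercolationContinuityZ3.Theorems

open MeasureTheory Literature.Probability.LatticeModels Literature.Probability.Percolation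
open scoped Classical BigOperators

/-- TTRL-lite variant V139 of `stub_goodStep` (stmt-CriticalPhenomena-4576): the inductive step of
the good-quadruple inequality on five vertices.  The observer `o` and its low neighbour `y ≠ o`
both lie outside the relay set `A`, so `A.card ≤ 5 - 2 = 3` and the unconditional two-relay case
`stub_goodStepTwoRelays_k41` applies (the induction hypothesis is not needed). -/
theorem stub_goodStep_var139 : ∀ (w : Sym2 (Fin 5) → unitInterval) (A : Finset (Fin 5)) (o b : Fin 5), b ∈ A → o ∉ A → (∃ y : Fin 5, y ∉ A ∧ y ≠ o ∧ (w s(o, y) : ℝ) ≠ 0) → (∀ w' : Sym2 (Fin 5) → unitInterval, (Finset.univ.filter (fun v : Fin 5 => ∃ u : Fin 5, 0 < (w' s(u, v) : ℝ))).card < (Finset.univ.filter (fun v : Fin 5 => ∃ u : Fin 5, 0 < (w s(u, v) : ℝ))).card → ∀ (A' : Finset (Fin 5)) (o' b' : Fin 5), b' ∈ A' → o' ∉ A' → ∀ (t : ℝ) (sel : Finset (Fin 5) → Fin 5), (∀ W, sel W ∈ A') → (∀ a ∈ A', 1 - t ≤ (prodBernoulli w').real (openConn a b')) → (prodBernoulli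 w').real ((⋃ a ∈ A', openConn o' a) ∩ (openConn o' b')ᶜ) + ∑ W ∈ (Finset.univ : Finset (Finset (Fin 5))).filter (fun W => o' ∈ W ∧ Disjoint W A'), (prodBernoulli w').real {ω : BondConfig (Fin 5) | openCluster ω o' = (W : Set (Fin 5))} * (prodBernoulli w').real (openConnIn ((W : Set (Fin 5))ᶜ) (sel W) b')ᶜ ≤ t) → ∀ (t : ℝ) (sel : Finset (Fin 5) → Fin 5), (∀ W, sel W ∈ A) → (∀ a ∈ A, 1 - t ≤ (prodBernoulli w).real (openConn a b)) → (prodBernoulli w).real ((⋃ a ∈ A, openConn o a) ∩ (openConn o b)ᶜ) + ∑ W ∈ (Finset.univ : Finset (Finset (Fin 5))).filter (fun W => o ∈ W ∧ Disjoint W A), (prodBernoulli w).real {ω : BondConfig (Fin 5) | openCluster ω o = (W : Set (Fin 5))} * (prodBernoulli w).real (openConnIn ((W : Set (Fin 5))ᶜ) (sel W) b)ᶜ ≤ t := by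
  intro w A o b hbA hoA hy _hIH t sel hsel hlev
  obtain ⟨y, hyA, hyo, -⟩ := hy
  refine stub_goodStepTwoRelays_k41 5 w A o b hbA hoA ?_ t sel hsel hlev
  have h1 : o ∉ insert y A := by
    simp only [Finset.mem_insert, not_or]
    exact ⟨fun h => hyo h.symm, hoA⟩
  have h2 := Finset.card_insert_of_notMem h1
  rw [Finset.card_insert_of_notMem hyA] at h2
  have h3 : (insert o (insert y A)).card ≤ 5 := by
    calc (insert o (insert y A)).card ≤ (Finset.univ : Finset (Fin 5)).card := Finset.card_le_univ _
      _ = 5 := by simp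
  omega

end Summit.CriticalPhenomena.PercolationContinuityZ3.Theorems
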